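import Summits.HubbardSuperconductivity.HubbardSuperconductivity.Theorems.KLProgrammeKLRegimeSplitEdgeFactsRelTransferProfile
import Summits.HubbardSuperconductivity.HubbardSuperconductivity.Theorems.KLProgrammeKLRegimeEngineV8PairTransferRelBarIdx

/-!
# Route `KLProgramme`, crux K3 — engine-flow child (stmt-HubbardSuperconductivity-20437), (X).3 class-#5 STEP, supplier row «(ᾱ)-WINDOW» IN INDEX-MASS UNITS
# (k3c1-p1 g15 l.7899 ask (i): «`Aw`, `Z` of the row-62 profile `α` in units of `klIdxMass n j′`»)

Cell gate-hubbard-kl, seat p1 g22.  The relative transfer profile of the STEP (row 62),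
`α(c) = |t_{n+1}[s_{n+1,j}](c) − t_{n+1}[s_{n+1,j′}](c)| + Maj(s_{n+1,j} − s_{n+1,j′}, s_{n,n+1})(Qm,c) + Maj(s_{n,n+1}, s_{n+1,j} − s_{n+1,j′})(Qm,c)`,
has WINDOW DATA `(η₀, Aw, Z)` (`∀ x₀ η, η₀ ≤ η → Σ_{|c−x₀|_𝕋 ≤ η} α c ≤ Aw·η`, `Σ_c α c ≤ Z`).  p1 g21's `sum_window_relTransferProfile_le_linear` gives
`Aw = (4·61524/π)·4^{−(j′−(n+1))}`, `η₀ = π/L`.  Here: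
* §1 `sum_window_relTransferProfile_le` — the `ρ`-form (any `ρ ≥ 0`): `≤ 123048·(ρ/π + 1/L)·4^{−(j′−(n+1))}` (same three constituents, `ρ`-forms
  `sum_window_abs_klTransferWeight_compl_sub_le` / `sum_window_softSymbol_mul_norm_propCT_le`);
* §1 `sum_relTransferProfile_le` — the TOTAL MASS (`ρ = π` is everything, `klTorusNorm_le_pi`): **`Z = 123048·(1 + 1/L)·4^{−(j′−(n+1))}`**;
* §2 the same three rows in the currency `klIdxMass n j′ = 15367·4^{−(j′−n)}` of the class-#5 index bookkeeping (`4^{−(j′−(n+1))} = 4·4^{−(j′−n)}` for `n+1 ≤ j′`):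
  **`Aw = (984384/(15367·π))·klIdxMass n j′ ≤ 21·klIdxMass n j′`** (`sum_window_relTransferProfile_le_klIdxMass`, `_le_klIdxMass'`),
  **`Z = (492192/15367)·(1 + 1/L)·klIdxMass n j′ ≤ 33·klIdxMass n j′`** (`sum_relTransferProfile_le_klIdxMass`, `_le_klIdxMass'`; `L ≥ β ≥ klBetaMin = 128`).
Numerically `984384/(15367π) = 20.39…`, `492192/15367 = 32.03…`.

Proofs only; no definitions; nothing here asserts (X).3, (c), any stub of 20437, K3 or superconductivity.  References: BGM 2006 §3 (sector/transfer bookkeeping)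
[cite: BenfattoGiulianiMastropietro2006]; FST II [cite: FeldmanSalmhoferTrubowitz1998].
-/

noncomputable section

namespace Summit.HubbardSuperconductivity.HubbardSuperconductivity.Theorems.KLRegimeSplit

set_option linter.dupNamespace false -- summit = problem name (single-conjunct summit), D-0017

open Real Finset Set Literature.MathematicalPhysics.QuantumLattice Literature.Probability.LatticeModels
open Summit.HubbardSuperconductivity.HubbardSuperconductivity.Theorems.DispersionFlow
open Summit.HubbardSuperconductivity.HubbardSuperconductivity.Theorems.KLProgrammeLegKernels
open Summit.HubbardSuperconductivity.HubbardSuperconductivity.Theorems.TwoPointAssembly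
open Summit.HubbardSuperconductivity.HubbardSuperconductivity.Theorems.KLRegimeWick

variable {L M : ℕ} [NeZero L] (β μ : ℝ) (K : TrigPolyC4v) {R : RenConsts} {U : ℝ} {N : ℕ}

/-! ## §1 The `ρ`-form and the total mass -/

/-- **Windowed mass of the relative transfer profile, `ρ`-form** (any radius `ρ ≥ 0`): for `FrameOK R U N μ K`, `klBetaMin ≤ β ≤ L`, `n + 1 ≤ j′ ≤ j`,
`Σ_{c : |c−x|_𝕋 ≤ ρ} α(c) ≤ 123048·(ρ/π + 1/L)·4^{−(j′−(n+1))}` (transfer part `61524·(ρ/π+1/L)·4^{−(j′−(n+1))}`, each bubble majorant half of that). -/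
theorem sum_window_relTransferProfile_le (hK : FrameOK R U N μ K) (hβ : klBetaMin ≤ β) (hβL : β ≤ L) {n j j' : ℕ} (hj' : n + 1 ≤ j') (hjj : j' ≤ j)
    (Qm x : TorusSite 2 L) {ρ : ℝ} (hρ : 0 ≤ ρ) :
    ∑ c ∈ (univ : Finset (TorusSite 2 L)).filter (fun c => klTorusNorm L (c - x) ≤ ρ),
        (|klTransferWeight L M β μ K (n + 1) (softSymbolCompl L M β μ K (n + 1) j) Qm c -
            klTransferWeight L M β μ K (n + 1) (softSymbolCompl L M β μ K (n + 1) j') Qm c| +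
          klBubbleMaj L M β μ K (softSymbolCompl L M β μ K (n + 1) j - softSymbolCompl L M β μ K (n + 1) j')
            (softSymbolCompl L M β μ K n (n + 1)) Qm c +
          klBubbleMaj L M β μ K (softSymbolCompl L M β μ K n (n + 1))
            (softSymbolCompl L M β μ K (n + 1) j - softSymbolCompl L M β μ K (n + 1) j') Qm c) ≤
      123048 * (ρ / π + ((L : ℝ))⁻¹) * ((4 : ℝ) ^ (j' - (n + 1)))⁻¹ := by
  have hβ0 : 0 < β := pos_of_klBetaMin_le hβ
  have hL : (0 : ℝ) < L := lt_of_lt_of_le hβ0 hβL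
  have hπ := Real.pi_pos
  have hΛ1 : 0 < klScale klE0 (n + 1) := klth_klScale_pos (n + 1)
  set d : FreqMomentum L M → ℝ := softSymbolCompl L M β μ K (n + 1) j - softSymbolCompl L M β μ K (n + 1) j' with hd
  have hdmem : ∀ k, 0 ≤ d k ∧ d k ≤ 1 - hubbardCutoffWeightCT L M β μ K (klScale klE0 j') k := fun k =>
    softSymbolCompl_sub_compl_mem β μ K (n + 1) hjj k
  have hA := softSymbolCompl_succ_mul_norm_propCT_le (L := L) (M := M) β μ K n
  -- (i) the transfer part, `ρ`-form
  have h1 := sum_window_abs_klTransferWeight_compl_sub_le (L := L) (M := M) β μ K hK hβ hβL hj' hjj Qm x hρ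
  -- (ii) `Maj(d, s_{n,n+1})`: sup on the right factor, windowed mass of `d` (centre `x`)
  have h2a := sum_window_klBubbleMaj_le_of_right (L := L) (M := M) β μ K hβ0 d hA Qm x ρ
  have h2b := sum_window_softSymbol_mul_norm_propCT_le (L := L) (M := M) β μ K hK hβ hβL j' hdmem x hρ
  -- (iii) `Maj(s_{n,n+1}, d)`: sup on the left factor, windowed mass of `d` (centre `Qm − x`)
  have h3a := sum_window_klBubbleMaj_le_of_left (L := L) (M := M) β μ K hβ0 d hA Qm x ρ
  have h3b := sum_window_softSymbol_mul_norm_propCT_le (L := L) (M := M) β μ K hK hβ hβL j' hdmem (Qm - x) hρ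
  -- the scale ratio `Λ_{j′} = 4^{−(j′−(n+1))}·Λ_{n+1}`
  have hratio : klScale klE0 j' = ((4 : ℝ) ^ (j' - (n + 1)))⁻¹ * klScale klE0 (n + 1) := klScale_eq_pow_mul_of_le hj'
  have hc0 : 0 ≤ (β * (L : ℝ) ^ 2)⁻¹ * (2 / klScale klE0 (n + 1)) := by positivity
  have hbub : ∀ (W : ℝ), W ≤ 15381 * (ρ / π + ((L : ℝ))⁻¹) * klScale klE0 j' * β * (L : ℝ) ^ 2 →
      (β * (L : ℝ) ^ 2)⁻¹ * (2 / klScale klE0 (n + 1)) * W ≤ 30762 * (ρ / π + ((L : ℝ))⁻¹) * ((4 : ℝ) ^ (j' - (n + 1)))⁻¹ := by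
    intro W hW
    calc (β * (L : ℝ) ^ 2)⁻¹ * (2 / klScale klE0 (n + 1)) * W
        ≤ (β * (L : ℝ) ^ 2)⁻¹ * (2 / klScale klE0 (n + 1)) * (15381 * (ρ / π + ((L : ℝ))⁻¹) * klScale klE0 j' * β * (L : ℝ) ^ 2) :=
          mul_le_mul_of_nonneg_left hW hc0
      _ = 30762 * (ρ / π + ((L : ℝ))⁻¹) * ((4 : ℝ) ^ (j' - (n + 1)))⁻¹ := by
          rw [hratio]
          field_simp
          ring
  rw [Finset.sum_add_distrib, Finset.sum_add_distrib]
  have h2 := hbub _ h2b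
  have h3 := hbub _ h3b
  calc _ ≤ 61524 * (ρ / π + ((L : ℝ))⁻¹) * ((4 : ℝ) ^ (j' - (n + 1)))⁻¹ + 30762 * (ρ / π + ((L : ℝ))⁻¹) * ((4 : ℝ) ^ (j' - (n + 1)))⁻¹ +
          30762 * (ρ / π + ((L : ℝ))⁻¹) * ((4 : ℝ) ^ (j' - (n + 1)))⁻¹ :=
        add_le_add (add_le_add h1 (h2a.trans h2)) (h3a.trans h3)
    _ = 123048 * (ρ / π + ((L : ℝ))⁻¹) * ((4 : ℝ) ^ (j' - (n + 1)))⁻¹ := by ring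

/-- **TOTAL MASS of the relative transfer profile** (the window `ρ = π` is everything): for `FrameOK R U N μ K`, `klBetaMin ≤ β ≤ L`, `n + 1 ≤ j′ ≤ j`,
`Σ_c α(c) ≤ 123048·(1 + 1/L)·4^{−(j′−(n+1))}` — the window datum `Z` of (R200)(1)/k3c1-p1 row 68. -/
theorem sum_relTransferProfile_le (hK : FrameOK R U N μ K) (hβ : klBetaMin ≤ β) (hβL : β ≤ L) {n j j' : ℕ} (hj' : n + 1 ≤ j') (hjj : j' ≤ j)
    (Qm : TorusSite 2 L) :
    ∑ c : TorusSite 2 L,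
        (|klTransferWeight L M β μ K (n + 1) (softSymbolCompl L M β μ K (n + 1) j) Qm c -
            klTransferWeight L M β μ K (n + 1) (softSymbolCompl L M β μ K (n + 1) j') Qm c| +
          klBubbleMaj L M β μ K (softSymbolCompl L M β μ K (n + 1) j - softSymbolCompl L M β μ K (n + 1) j')
            (softSymbolCompl L M β μ K n (n + 1)) Qm c +
          klBubbleMaj L M β μ K (softSymbolCompl L M β μ K n (n + 1))
            (softSymbolCompl L M β μ K (n + 1) j - softSymbolCompl L M β μ K (n + 1) j') Qm c) ≤
      123048 * (1 + ((L : ℝ))⁻¹) * ((4 : ℝ) ^ (j' - (n + 1)))⁻¹ := by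
  have hπ := Real.pi_pos
  have h := sum_window_relTransferProfile_le (L := L) (M := M) β μ K hK hβ hβL hj' hjj Qm 0 Real.pi_pos.le
  have hall : ((univ : Finset (TorusSite 2 L)).filter fun c => klTorusNorm L (c - 0) ≤ π) = (univ : Finset (TorusSite 2 L)) := by
    refine Finset.filter_true_of_mem fun c _ => ?_
    exact klTorusNorm_le_pi (c - 0)
  rw [hall, div_self hπ.ne'] at h
  exact h

/-! ## §2 The same rows in index-mass units `klIdxMass n j′ = 15367·4^{−(j′−n)}` -/

omit [NeZero L] in
/-- The unit conversion: for `n + 1 ≤ j′`, `4^{−(j′−(n+1))} = (4/15367)·klIdxMass n j′`. -/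
theorem pow_inv_eq_klIdxMass {n j' : ℕ} (hj' : n + 1 ≤ j') :
    ((4 : ℝ) ^ (j' - (n + 1)))⁻¹ = 4 / 15367 * klIdxMass n j' := by
  have hsplit : j' - n = (j' - (n + 1)) + 1 := by omega
  rw [klIdxMass, hsplit, pow_succ]
  have h4 : (4 : ℝ) ^ (j' - (n + 1)) ≠ 0 := pow_ne_zero _ (by norm_num)
  field_simp

/-- **`Aw` in index-mass units**: for `π/L ≤ η`, `Σ_{c : |c−x|_𝕋 ≤ η} α(c) ≤ (984384/(15367·π))·klIdxMass n j′·η` (`984384/(15367π) = 20.39…`). -/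
theorem sum_window_relTransferProfile_le_klIdxMass (hK : FrameOK R U N μ K) (hβ : klBetaMin ≤ β) (hβL : β ≤ L) {n j j' : ℕ} (hj' : n + 1 ≤ j')
    (hjj : j' ≤ j) (Qm x : TorusSite 2 L) {η : ℝ} (hη : Real.pi / L ≤ η) :
    ∑ c ∈ (univ : Finset (TorusSite 2 L)).filter (fun c => klTorusNorm L (c - x) ≤ η),
        (|klTransferWeight L M β μ K (n + 1) (softSymbolCompl L M β μ K (n + 1) j) Qm c -
            klTransferWeight L M β μ K (n + 1) (softSymbolCompl L M β μ K (n + 1) j') Qm c| +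
          klBubbleMaj L M β μ K (softSymbolCompl L M β μ K (n + 1) j - softSymbolCompl L M β μ K (n + 1) j')
            (softSymbolCompl L M β μ K n (n + 1)) Qm c +
          klBubbleMaj L M β μ K (softSymbolCompl L M β μ K n (n + 1))
            (softSymbolCompl L M β μ K (n + 1) j - softSymbolCompl L M β μ K (n + 1) j') Qm c) ≤
      984384 / (15367 * Real.pi) * klIdxMass n j' * η := by
  refine (sum_window_relTransferProfile_le_linear (L := L) (M := M) β μ K hK hβ hβL hj' hjj Qm x hη).trans (le_of_eq ?_)
  rw [pow_inv_eq_klIdxMass hj']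
  have hπ := Real.pi_pos.ne'
  field_simp
  ring

/-- **`Aw ≤ 21·klIdxMass n j′`** (the rounded form: `984384/(15367π) < 21` by `π > 3.14`). -/
theorem sum_window_relTransferProfile_le_klIdxMass' (hK : FrameOK R U N μ K) (hβ : klBetaMin ≤ β) (hβL : β ≤ L) {n j j' : ℕ} (hj' : n + 1 ≤ j')
    (hjj : j' ≤ j) (Qm x : TorusSite 2 L) {η : ℝ} (hη : Real.pi / L ≤ η) :
    ∑ c ∈ (univ : Finset (TorusSite 2 L)).filter (fun c => klTorusNorm L (c - x) ≤ η),
        (|klTransferWeight L M β μ K (n + 1) (softSymbolCompl L M β μ K (n + 1) j) Qm c -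
            klTransferWeight L M β μ K (n + 1) (softSymbolCompl L M β μ K (n + 1) j') Qm c| +
          klBubbleMaj L M β μ K (softSymbolCompl L M β μ K (n + 1) j - softSymbolCompl L M β μ K (n + 1) j')
            (softSymbolCompl L M β μ K n (n + 1)) Qm c +
          klBubbleMaj L M β μ K (softSymbolCompl L M β μ K n (n + 1))
            (softSymbolCompl L M β μ K (n + 1) j - softSymbolCompl L M β μ K (n + 1) j') Qm c) ≤
      21 * klIdxMass n j' * η := by
  have hL : (0 : ℝ) < L := Nat.cast_pos.2 (Nat.pos_of_ne_zero (NeZero.ne L))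
  have hη0 : 0 ≤ η := le_trans (by positivity) hη
  have hI : 0 ≤ klIdxMass n j' := by unfold klIdxMass; positivity
  refine (sum_window_relTransferProfile_le_klIdxMass (L := L) (M := M) β μ K hK hβ hβL hj' hjj Qm x hη).trans ?_
  have hπ3 : (3.14 : ℝ) < Real.pi := by linarith [Real.pi_gt_d2]
  have hc : 984384 / (15367 * Real.pi) ≤ 21 := by
    rw [div_le_iff₀ (by positivity)]
    nlinarith
  exact mul_le_mul_of_nonneg_right (mul_le_mul_of_nonneg_right hc hI) hη0

/-- **`Z` in index-mass units**: `Σ_c α(c) ≤ (492192/15367)·(1 + 1/L)·klIdxMass n j′` (`492192/15367 = 32.03…`). -/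
theorem sum_relTransferProfile_le_klIdxMass (hK : FrameOK R U N μ K) (hβ : klBetaMin ≤ β) (hβL : β ≤ L) {n j j' : ℕ} (hj' : n + 1 ≤ j') (hjj : j' ≤ j)
    (Qm : TorusSite 2 L) :
    ∑ c : TorusSite 2 L,
        (|klTransferWeight L M β μ K (n + 1) (softSymbolCompl L M β μ K (n + 1) j) Qm c -
            klTransferWeight L M β μ K (n + 1) (softSymbolCompl L M β μ K (n + 1) j') Qm c| +
          klBubbleMaj L M β μ K (softSymbolCompl L M β μ K (n + 1) j - softSymbolCompl L M β μ K (n + 1) j')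
            (softSymbolCompl L M β μ K n (n + 1)) Qm c +
          klBubbleMaj L M β μ K (softSymbolCompl L M β μ K n (n + 1))
            (softSymbolCompl L M β μ K (n + 1) j - softSymbolCompl L M β μ K (n + 1) j') Qm c) ≤
      492192 / 15367 * (1 + ((L : ℝ))⁻¹) * klIdxMass n j' := by
  refine (sum_relTransferProfile_le (L := L) (M := M) β μ K hK hβ hβL hj' hjj Qm).trans (le_of_eq ?_)
  rw [pow_inv_eq_klIdxMass hj']
  ring

/-- **`Z ≤ 33·klIdxMass n j′`** (the rounded form: `L ≥ β ≥ klBetaMin = 128` ⇒ `(492192/15367)·(1 + 1/L) ≤ (492192/15367)·(129/128) < 33`). -/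
theorem sum_relTransferProfile_le_klIdxMass' (hK : FrameOK R U N μ K) (hβ : klBetaMin ≤ β) (hβL : β ≤ L) {n j j' : ℕ} (hj' : n + 1 ≤ j') (hjj : j' ≤ j)
    (Qm : TorusSite 2 L) :
    ∑ c : TorusSite 2 L,
        (|klTransferWeight L M β μ K (n + 1) (softSymbolCompl L M β μ K (n + 1) j) Qm c -
            klTransferWeight L M β μ K (n + 1) (softSymbolCompl L M β μ K (n + 1) j') Qm c| +
          klBubbleMaj L M β μ K (softSymbolCompl L M β μ K (n + 1) j - softSymbolCompl L M β μ K (n + 1) j')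
            (softSymbolCompl L M β μ K n (n + 1)) Qm c +
          klBubbleMaj L M β μ K (softSymbolCompl L M β μ K n (n + 1))
            (softSymbolCompl L M β μ K (n + 1) j - softSymbolCompl L M β μ K (n + 1) j') Qm c) ≤
      33 * klIdxMass n j' := by
  have hβ128 : (128 : ℝ) ≤ β := by have : klBetaMin = 128 := rfl; rw [← this]; exact hβ
  have hL128 : (128 : ℝ) ≤ L := hβ128.trans hβL
  have hL : (0 : ℝ) < L := by linarith
  have hI : 0 ≤ klIdxMass n j' := by unfold klIdxMass; positivity
  refine (sum_relTransferProfile_le_klIdxMass (L := L) (M := M) β μ K hK hβ hβL hj' hjj Qm).trans ?_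
  have hinv : ((L : ℝ))⁻¹ ≤ 1 / 128 := by
    rw [inv_eq_one_div]; exact one_div_le_one_div_of_le (by norm_num) hL128
  have hc : 492192 / 15367 * (1 + ((L : ℝ))⁻¹) ≤ 33 := by
    calc 492192 / 15367 * (1 + ((L : ℝ))⁻¹) ≤ 492192 / 15367 * (1 + 1 / 128) := by gcongr
      _ ≤ 33 := by norm_num
  exact mul_le_mul_of_nonneg_right hc hI

end Summit.HubbardSuperconductivity.HubbardSuperconductivity.Theorems.KLRegimeSplit

end
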